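import Summits.QuantumFields.YangMills.Theorems.BalabanUVNodesN21DilationRoadEnd
import Summits.QuantumFields.YangMills.Theorems.BalabanUVNodesN21AtSRec13CoPHWeight
import Summits.QuantumFields.YangMills.Theorems.BalabanUVNodesN21AtSRec13CoPHOnWeight

/-!
# YM-DAG node N21 (= NE7c) · THE DILATION ROAD'S END KEYED AT THE STAGE-13 `CoPH` SPINE HOME: level constants
# `M_j · 3(d_j + 1)∕(1 − ρ_j)` (G28 ∕ G34 ∕ 38l's `3(#κ+1)(1+Q)∕(κ₀(1−ρ)) = ((1+Q)∕κ₀) · 3(#κ+1)∕(1−ρ)`, G26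
# `dilationConst_transversal_eq`) with POLYNOMIAL multiplier and block dimension and geometric widths `≤ ½` ⇒
# `T4IndicatorShell.ShellWeightBound` at explicit carriers (ROW T BY NAME) ⇒ the ∃-weight face, `S_N21 (SRec₁₃CoPH cr)` ∕
# `S_N21 (SRec₁₃CoPHOn cr Rg)` and leaf D's guarded `h21` binder shape at every reading `cr : SpineReading₁₃CoPH N`

Track A of `YM-PLAN.md` (cell `pub-ymgap`, HUMAN RULING D-0062 ∕ D-0149 width seats), node **N21**; WIDTH SEAT
`pub-ymgap-dag-n21-w2` (gen 0), W-SEAT-START-LIST v3 §n21 ITEM 2 «`KeyedShellWeight cr` (leaf D's `h21`) AT THE RECORD from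
n21-d ∕ n21-e outputs BY NAME — the KNIT at the record».  THEOREMS ONLY: 0 `def`, 0 `sorry`, standard axioms; COUNT-NEUTRAL;
`--kind proof --supports stmt-QuantumFields-20544 --as helper` (K3⁷ `SpineGivenEndpointR13SepCoPH`).  `N`-generic, NO Theses import
(restate-immune).  Imports n21-d's G17 `…N21DilationRoadEnd` (brings ROW T `…N21LevelLedgerLinearGrowth`), module 21a
`…N21AtSRec13CoPHWeight` (brings dag-n27-c's home `…SpineCarriersOfRecord13CoPH`) and module 26 `…N21AtSRec13CoPHOnWeight`
(brings dag-n19-d's `s_N21_sRec₁₃CoPHOn_iff`).  Restates nothing; cites by name.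

WHY.  Road I (level ledgers at N16's (F∞)-rate under `InEndRegime`) is knit to the Stage-13 record by n21-d's modules 21a–26
(`…AtSRec13CoPHWeight`, `…AtRRec13CoPHConstLayer`, `…AtReadingOfRecord13CoPH`).  Road II's DILATION outputs are not: G17
`shellWeightBound_of_levels_dilation` (multiplier `M ≡ 1`) and G19 §E `shellWeightBound_of_levels_dilation_const` (ONE
level-independent `M = (1+Q)∕κ`) stop at explicit carriers, while the per-slot (M1) constants the road actually delivers — G28 P2
`slotAntiConcentration_restrict_of_recentredDilation`, G31 `…_of_lowCentre`, G34 `…_of_projectedCentre`, n21-e 38l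
`…_recentredDilation_collar` — read `3(#κ_j + 1)(1 + Q_j)∕(κ₀,j(1 − ρ_j))` with odds `Q_j` and transversality `κ₀,j` that vary
with the slot's level (lens Card 90: the profile letter enters LINEARLY; ROW T: polynomial growth is absorbed by the geometric
width).  This file types the missing composition once, with the multiplier `M_j` of POLYNOMIAL growth, and keys it at the record.

WHAT IS PROVED ([folklore] ∕ [bookkeeping]; every step ONE application BY NAME or arithmetic).
* §1 arithmetic: `poly_succ_mul_poly_succ_le` (`(x^q+1)(x^p+1) ≤ 2(x^{p+q}+1)`, `x ≥ 0`) · `dilationCoeffConst_nonneg` ·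
  `dilationCoeffConst_le_pow` (`M_j·3(d_j+1)∕(1−ρ_j) ≤ 12M̄(d₀+1)·(j^{p+q}+1)`) · `summable_dilationCoeffConst_mul` (ROW T
  `summable_of_pow_mul_geometric` BY NAME) · `coeff_le_of_odds_transversality` (`(1+Q)∕κ₀ ≤ (1+Q̄)∕κ̄`).
* §2 at explicit carriers: ★ `shellWeightBound_of_levels_dilationCoeff` (two `LevelLedger`s with constants
  `M_j·3(d_j+1)∕(1−ρ_j)` in `LiveWindow`s ⇒ `ShellWeightBound … (ω^A + ω^B)`, ROW T `shellWeightBound_of_levels_summable` BY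
  NAME) · `eventually_omega_add_lt_dilationCoeff` · `shellWeightBound_of_levels_dilationCoeff_mono` (any dominating summable
  weight, `shellWeightBound_mono`) · `exists_shellWeight_of_dilationLevels` (the ∃-weight currency from an ∃-package over the
  slot data at a carrier bundle `S : SpineCarriers`).
* §3 AT THE RECORD, `cr : SpineReading₁₃CoPH N` a PARAMETER: ★ `exists_shellWeight_keyed₁₃CoPH_of_dilationLevels` (the ∃-weight
  face at every admissible Stage-13 tuple with provisos) · ★★ `exists_reweight_s_N21_sRec₁₃CoPH_of_dilationLevels` (`∃ w`, the K5
  stub at the re-weighted reading; 21a §3 BY NAME) · `s_N21_sRec₁₃CoPH_of_dilationLevels` (the stub at `cr` itself when its weight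
  slot is summable and dominates `ω^A + ω^B`; 21a §1 BY NAME) · the regime-home twins `exists_reweight_s_N21_sRec₁₃CoPHOn_of_dilationLevels`
  ∕ `s_N21_sRec₁₃CoPHOn_of_dilationLevels` (26 ∕ dag-n19-d BY NAME) · ★ `shellWeightBound_guarded₁₃CoPH_of_dilationLevels` — leaf D
  `spineGivenEndpointR13SepCoPH_of_keyedFacesP`'s binder `h21` VERBATIM at `Rg F θ := θ.ZhUnity F N ∧ θ.SlotsNondegenerate₁₃ F N`,
  `N = 2`.
* A2∕A6 (vacuity guard) is the COMPANION file `…N21DilationRoadAtRecord13CoPHSanity` (the 400-line rule): the §2 ∃-package is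
  INHABITED by non-degenerate toy data (`T4ShellMeasureLevels.Toy` carriers as a level ledger with DILATION constants
  `1·3(0+1)∕(1−ρ_j)`, `ρ_j = ϑ^j∕2`) and §2 ∕ §3 FIRE on it (constant toy reading, record weight `6ϑ^K`).

HONEST FRAMING (binding).  Bookkeeping BY NAME: the two `LevelLedger`s ((M1) per level — NOT PRINTED — + the [dict] fields
`sh_nonneg ∕ sh_le ∕ cover`), the `LiveWindow`s (N20's window ∕ count), the multiplier ∕ block-dimension ∕ width letters
(`M_j = (1+Q_j)∕κ₀,j`, `d_j = #κ_j`, `ρ_j`) are HYPOTHESES, displayed; `cr` is a PARAMETER (no reading of Bałaban's dressed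
two-run expansion exists in the tree — NODE O's term object); the passage (M1)-at-measure-level → `LevelLedger.slot` is n21-d's
G26 ∕ G28 §P′ (`slot_field_of_…`, [dict] binders `hpiece ∕ hAw`) and is NOT re-typed here; no inhabitant of any admissible Stage-13
tuple with provisos is claimed (K0⁷ OPEN); nothing of Bałaban's asserted; NE7 ∕ NE7b ∕ NE7c NOT PRINTED for d = 4 and NOT PROVED;
**N21 NOT discharged**, N27 NOT discharged, K3⁷ NOT claimed; counts UNMOVED (typed 28∕28 · discharged 5∕27); one finite four-torus
programme at fixed `ε` — NOT ℝ⁴, NOT infinite volume, NOT OS, NOT a mass gap, NOT Clay.  No decl below carries a cite tag.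
-/

set_option autoImplicit false

open Finset Filter

namespace Summit.QuantumFields.YangMills.Theorems.N21DilationRoadAtRecord13CoPH

open Literature.MathematicalPhysics.QuantumFieldTheory.Balaban1983to89
open Literature.MathematicalPhysics.QuantumFieldTheory.Balaban1983to89.T4Continuum (T4Family ULoop)
open T4IndicatorShell (ShellWeightBound)
open T4ShellMeasureLevels (LevelLedger LiveWindow)
open YMDAG.UVSplit
open Node00 (Stage13HParams datumOfRecord₁₃CoPH)
open N21LevelLedgerLinearGrowth (summable_of_pow_mul_geometric shellWeightBound_of_levels_summable
  eventually_omega_add_lt_summable)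
open N21DilationRoadEnd (dilationConst_le dilationConst_nonneg)
open N21AtSRec13CoPHWeight (s_N21_sRec₁₃CoPH_of_le_weight exists_reweight_s_N21_sRec₁₃CoPH)
open N21AtSRec13CoPHOnWeight (exists_reweight_s_N21_sRec₁₃CoPHOn)
open Summit.QuantumFields.YangMills.BalabanUVNodes.N19TargetAtHomes13CoPHOn (s_N21_sRec₁₃CoPHOn_iff)

/-! ## §1 Arithmetic of the dilation level constants with a polynomial multiplier -/

/-- `(x^q + 1)(x^p + 1) ≤ 2(x^{p+q} + 1)` for `x ≥ 0` (⟺ `(x^p − 1)(x^q − 1) ≥ 0`: both factors have the sign of `x − 1`).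
[folklore] -/
theorem poly_succ_mul_poly_succ_le {x : ℝ} (hx : 0 ≤ x) (p q : ℕ) :
    (x ^ q + 1) * (x ^ p + 1) ≤ 2 * (x ^ (p + q) + 1) := by
  have key : 0 ≤ (x ^ p - 1) * (x ^ q - 1) := by
    rcases le_total x 1 with h | h
    · exact mul_nonneg_of_nonpos_of_nonpos (sub_nonpos.2 (pow_le_one₀ hx h)) (sub_nonpos.2 (pow_le_one₀ hx h))
    · exact mul_nonneg (sub_nonneg.2 (one_le_pow₀ h)) (sub_nonneg.2 (one_le_pow₀ h))
  have e : x ^ (p + q) = x ^ p * x ^ q := pow_add x p q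
  nlinarith [key, e]

/-- the dilation level constant with a nonnegative multiplier is nonnegative (`ρ < 1`, `d ≥ 0`, `M ≥ 0`). [folklore] -/
theorem dilationCoeffConst_nonneg {M d ρ : ℝ} (hM : 0 ≤ M) (hd : 0 ≤ d) (hρ : ρ < 1) :
    0 ≤ M * (3 * (d + 1) / (1 - ρ)) :=
  mul_nonneg hM (dilationConst_nonneg hd hρ)

/-- **POLYNOMIAL MULTIPLIER × POLYNOMIAL BLOCK DIMENSION ⇒ POLYNOMIAL LEVEL CONSTANT**: `0 ≤ M_j ≤ M̄(j^q+1)`,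
`0 ≤ d_j ≤ d₀(j^p+1)`, `ρ_j ≤ ½` ⇒ `M_j·3(d_j+1)∕(1−ρ_j) ≤ 12·M̄·(d₀+1)·(j^{p+q}+1)` (G17 `dilationConst_le` + §1's product
bound). [folklore] -/
theorem dilationCoeffConst_le_pow {M d ρ : ℕ → ℝ} {Mbar d₀ : ℝ} {p q : ℕ} (hM0 : ∀ j, 0 ≤ M j)
    (hM : ∀ j, M j ≤ Mbar * ((j : ℝ) ^ q + 1)) (hd0 : ∀ j, 0 ≤ d j) (hd : ∀ j, d j ≤ d₀ * ((j : ℝ) ^ p + 1))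
    (hρ : ∀ j, ρ j ≤ 1 / 2) (j : ℕ) :
    M j * (3 * (d j + 1) / (1 - ρ j)) ≤ (12 * Mbar * (d₀ + 1)) * ((j : ℝ) ^ (p + q) + 1) := by
  have hjq : (1 : ℝ) ≤ (j : ℝ) ^ q + 1 := by
    have : (0 : ℝ) ≤ (j : ℝ) ^ q := by positivity
    linarith
  have hjp : (1 : ℝ) ≤ (j : ℝ) ^ p + 1 := by
    have : (0 : ℝ) ≤ (j : ℝ) ^ p := by positivity
    linarith
  have hMbar : 0 ≤ Mbar := by
    have h := (hM0 j).trans (hM j)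
    by_contra hc
    rw [not_le] at hc
    nlinarith
  have hd₀ : 0 ≤ d₀ := by
    have h := (hd0 j).trans (hd j)
    by_contra hc
    rw [not_le] at hc
    nlinarith
  have h1 : 3 * (d j + 1) / (1 - ρ j) ≤ 6 * (d j + 1) := dilationConst_le (hd0 j) (hρ j)
  have h2 : 6 * (d j + 1) ≤ 6 * (d₀ + 1) * ((j : ℝ) ^ p + 1) := by nlinarith [hd j, hd0 j]
  have h3 : 0 ≤ 3 * (d j + 1) / (1 - ρ j) := dilationConst_nonneg (hd0 j) (by linarith [hρ j])
  calc M j * (3 * (d j + 1) / (1 - ρ j))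
      ≤ (Mbar * ((j : ℝ) ^ q + 1)) * (6 * (d₀ + 1) * ((j : ℝ) ^ p + 1)) :=
        mul_le_mul (hM j) (h1.trans h2) h3 ((hM0 j).trans (hM j))
    _ = 6 * Mbar * (d₀ + 1) * (((j : ℝ) ^ q + 1) * ((j : ℝ) ^ p + 1)) := by ring
    _ ≤ 6 * Mbar * (d₀ + 1) * (2 * ((j : ℝ) ^ (p + q) + 1)) :=
        mul_le_mul_of_nonneg_left (poly_succ_mul_poly_succ_le (Nat.cast_nonneg j) p q)
          (mul_nonneg (mul_nonneg (by norm_num) hMbar) (by linarith))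
    _ = (12 * Mbar * (d₀ + 1)) * ((j : ℝ) ^ (p + q) + 1) := by ring

/-- **THE DILATION ROAD's TOLERANCE WITH A POLYNOMIAL MULTIPLIER IS SUMMABLE**: `Σ_j M_j·3(d_j+1)∕(1−ρ_j)·ρ_j < ∞` for
`0 ≤ M_j ≤ M̄(j^q+1)`, `0 ≤ d_j ≤ d₀(j^p+1)`, `0 ≤ ρ_j ≤ ½`, `ρ_j ≤ c₁ϑ^j`, `0 ≤ ϑ < 1` — ROW T's
`summable_of_pow_mul_geometric` BY NAME at degree `p + q` (G17 `summable_dilationConst_mul` is `M ≡ 1`). [folklore] -/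
theorem summable_dilationCoeffConst_mul {M d ρ : ℕ → ℝ} {Mbar d₀ c₁ ϑ : ℝ} {p q : ℕ} (hϑ0 : 0 ≤ ϑ) (hϑ1 : ϑ < 1)
    (hM0 : ∀ j, 0 ≤ M j) (hM : ∀ j, M j ≤ Mbar * ((j : ℝ) ^ q + 1)) (hd0 : ∀ j, 0 ≤ d j)
    (hd : ∀ j, d j ≤ d₀ * ((j : ℝ) ^ p + 1)) (hρ0 : ∀ j, 0 ≤ ρ j) (hρhalf : ∀ j, ρ j ≤ 1 / 2)
    (hρ : ∀ j, ρ j ≤ c₁ * ϑ ^ j) :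
    Summable (fun j => (M j * (3 * (d j + 1) / (1 - ρ j))) * ρ j) :=
  summable_of_pow_mul_geometric hϑ0 hϑ1
    (fun j => dilationCoeffConst_nonneg (hM0 j) (hd0 j) (by linarith [hρhalf j])) hρ0
    (dilationCoeffConst_le_pow hM0 hM hd0 hd hρhalf) hρ

/-- **UNIFORM ODDS AND TRANSVERSALITY BOUND THE MULTIPLIER**: `0 ≤ Q ≤ Q̄`, `0 < κ̄ ≤ κ₀` ⇒ `0 ≤ (1+Q)∕κ₀ ≤ (1+Q̄)∕κ̄`.  This is how
G28 ∕ G34 ∕ 38l's per-slot constant `((1+Q)∕κ₀)·3(#κ+1)∕(1−ρ)` (G26 `dilationConst_transversal_eq`) meets §2's multiplier binder: with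
level-UNIFORM odds and transversality take `M_j := (1+Q̄)∕κ̄` for every `j`, so `hMA`∕`hMB` hold at `q = 0` with `M̄ := (1+Q̄)∕κ̄` (since
`M̄·(j^0 + 1) = 2M̄ ≥ M̄`); polynomially growing odds enter through `M̄(j^q+1)` directly.  (v1.0.1: docstring re-worded, ref-O READ-5 NIT-2;
statement and proof unchanged.) [folklore] -/
theorem coeff_le_of_odds_transversality {Q Qbar κ₀ κbar : ℝ} (hQ0 : 0 ≤ Q) (hQ : Q ≤ Qbar) (hκ : 0 < κbar)
    (hκ₀ : κbar ≤ κ₀) : 0 ≤ (1 + Q) / κ₀ ∧ (1 + Q) / κ₀ ≤ (1 + Qbar) / κbar :=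
  ⟨div_nonneg (by linarith) (hκ.le.trans hκ₀),
    div_le_div₀ (by linarith) (by linarith) hκ hκ₀⟩

/-! ## §2 The END at explicit carriers: two level ledgers with dilation constants `M_j·3(d_j+1)∕(1−ρ_j)` -/

section TwoRuns

variable {ι σ σ' : Type*} {l₀ : ℝ} {T : ℕ → Finset ι} {A B shA shB : ℕ → ℝ → ι → ℝ}
  {SA : ℕ → Finset σ} {SB : ℕ → Finset σ'} {pieceA : ℕ → ℝ → σ → ι → ℝ} {pieceB : ℕ → ℝ → σ' → ι → ℝ}
  {lvlA : ℕ → σ → ℕ} {lvlB : ℕ → σ' → ℕ} {MA dA ρA MB dB ρB : ℕ → ℝ} {N₁ : ℕ} {νbar Mbar d₀ c₁ ϑ : ℝ} {p q : ℕ}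

/-- ★ **NE7c FROM THE DILATION ROAD WITH A POLYNOMIAL MULTIPLIER (at the END, by name).**  Two level ledgers whose level
constants are `M_j · 3(d_j + 1)∕(1 − ρ_j)` — the per-slot `slot` fields being G26 `slot_field_of_radialTransversal` ∕ G28
`slot_field_of_recentredDilation` (∕ their G31 ∕ G34 ∕ 38l dischargings) with `M_j = (1+Q_j)∕κ₀,j`, `d_j = #κ_j` — in live
windows, with `0 ≤ M_j ≤ M̄(j^q+1)`, `0 ≤ d_j ≤ d₀(j^p+1)`, `ρ_j ≤ ½`, `ρ_j ≤ c₁ϑ^j`, `0 ≤ ϑ < 1`, give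
`T4IndicatorShell.ShellWeightBound l₀ T A B shA shB (ω^A + ω^B)` (ROW T `shellWeightBound_of_levels_summable` BY NAME; G17 is
`M ≡ 1`, G19 §E is `M` constant). HYPOTHESES only; NE7c NOT proved. [folklore] -/
theorem shellWeightBound_of_levels_dilationCoeff
    (hA : LevelLedger l₀ T A shA SA pieceA lvlA (fun j => MA j * (3 * (dA j + 1) / (1 - ρA j))) ρA)
    (hB : LevelLedger l₀ T B shB SB pieceB lvlB (fun j => MB j * (3 * (dB j + 1) / (1 - ρB j))) ρB)
    (hwA : LiveWindow SA lvlA N₁ νbar) (hwB : LiveWindow SB lvlB N₁ νbar)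
    (hϑ0 : 0 ≤ ϑ) (hϑ1 : ϑ < 1)
    (hMA0 : ∀ j, 0 ≤ MA j) (hMA : ∀ j, MA j ≤ Mbar * ((j : ℝ) ^ q + 1))
    (hMB0 : ∀ j, 0 ≤ MB j) (hMB : ∀ j, MB j ≤ Mbar * ((j : ℝ) ^ q + 1))
    (hdA0 : ∀ j, 0 ≤ dA j) (hdA : ∀ j, dA j ≤ d₀ * ((j : ℝ) ^ p + 1))
    (hdB0 : ∀ j, 0 ≤ dB j) (hdB : ∀ j, dB j ≤ d₀ * ((j : ℝ) ^ p + 1))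
    (hρAhalf : ∀ j, ρA j ≤ 1 / 2) (hρA : ∀ j, ρA j ≤ c₁ * ϑ ^ j)
    (hρBhalf : ∀ j, ρB j ≤ 1 / 2) (hρB : ∀ j, ρB j ≤ c₁ * ϑ ^ j) :
    ShellWeightBound l₀ T A B shA shB (fun K => hA.toSlotLedger.omega K + hB.toSlotLedger.omega K) :=
  shellWeightBound_of_levels_summable hA hB hwA hwB
    (summable_dilationCoeffConst_mul hϑ0 hϑ1 hMA0 hMA hdA0 hdA hA.ρ_nonneg hρAhalf hρA)
    (summable_dilationCoeffConst_mul hϑ0 hϑ1 hMB0 hMB hdB0 hdB hB.ρ_nonneg hρBhalf hρB)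

/-- … and the smallness the consumers want (`T4IndicatorShell.relWeightBound_ref`'s `hlt`): `ω^A K + ω^B K < ε` eventually
(ROW T `eventually_omega_add_lt_summable` BY NAME). [folklore] -/
theorem eventually_omega_add_lt_dilationCoeff
    (hA : LevelLedger l₀ T A shA SA pieceA lvlA (fun j => MA j * (3 * (dA j + 1) / (1 - ρA j))) ρA)
    (hB : LevelLedger l₀ T B shB SB pieceB lvlB (fun j => MB j * (3 * (dB j + 1) / (1 - ρB j))) ρB)
    (hwA : LiveWindow SA lvlA N₁ νbar) (hwB : LiveWindow SB lvlB N₁ νbar)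
    (hϑ0 : 0 ≤ ϑ) (hϑ1 : ϑ < 1)
    (hMA0 : ∀ j, 0 ≤ MA j) (hMA : ∀ j, MA j ≤ Mbar * ((j : ℝ) ^ q + 1))
    (hMB0 : ∀ j, 0 ≤ MB j) (hMB : ∀ j, MB j ≤ Mbar * ((j : ℝ) ^ q + 1))
    (hdA0 : ∀ j, 0 ≤ dA j) (hdA : ∀ j, dA j ≤ d₀ * ((j : ℝ) ^ p + 1))
    (hdB0 : ∀ j, 0 ≤ dB j) (hdB : ∀ j, dB j ≤ d₀ * ((j : ℝ) ^ p + 1))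
    (hρAhalf : ∀ j, ρA j ≤ 1 / 2) (hρA : ∀ j, ρA j ≤ c₁ * ϑ ^ j)
    (hρBhalf : ∀ j, ρB j ≤ 1 / 2) (hρB : ∀ j, ρB j ≤ c₁ * ϑ ^ j) {ε : ℝ} (hε : 0 < ε) :
    ∀ᶠ K in atTop, hA.toSlotLedger.omega K + hB.toSlotLedger.omega K < ε :=
  eventually_omega_add_lt_summable hA hB hwA hwB
    (summable_dilationCoeffConst_mul hϑ0 hϑ1 hMA0 hMA hdA0 hdA hA.ρ_nonneg hρAhalf hρA)
    (summable_dilationCoeffConst_mul hϑ0 hϑ1 hMB0 hMB hdB0 hdB hB.ρ_nonneg hρBhalf hρB) hε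

/-- **… FOR ANY DOMINATING SUMMABLE WEIGHT** (the record's weight slot): if `Wsh` is summable and dominates the explicit relative
shell weight `Σ_{s ∈ SA K} M·3(d+1)∕(1−ρ)·ρ ∣_{lvl s} + Σ_{s ∈ SB K} …` (= `ω^A K + ω^B K`, `LevelLedger.omega_eq`), then
`ShellWeightBound l₀ T A B shA shB Wsh` (n21-a `shellWeightBound_mono` BY NAME). [folklore] -/
theorem shellWeightBound_of_levels_dilationCoeff_mono
    (hA : LevelLedger l₀ T A shA SA pieceA lvlA (fun j => MA j * (3 * (dA j + 1) / (1 - ρA j))) ρA)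
    (hB : LevelLedger l₀ T B shB SB pieceB lvlB (fun j => MB j * (3 * (dB j + 1) / (1 - ρB j))) ρB)
    (hwA : LiveWindow SA lvlA N₁ νbar) (hwB : LiveWindow SB lvlB N₁ νbar)
    (hϑ0 : 0 ≤ ϑ) (hϑ1 : ϑ < 1)
    (hMA0 : ∀ j, 0 ≤ MA j) (hMA : ∀ j, MA j ≤ Mbar * ((j : ℝ) ^ q + 1))
    (hMB0 : ∀ j, 0 ≤ MB j) (hMB : ∀ j, MB j ≤ Mbar * ((j : ℝ) ^ q + 1))
    (hdA0 : ∀ j, 0 ≤ dA j) (hdA : ∀ j, dA j ≤ d₀ * ((j : ℝ) ^ p + 1))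
    (hdB0 : ∀ j, 0 ≤ dB j) (hdB : ∀ j, dB j ≤ d₀ * ((j : ℝ) ^ p + 1))
    (hρAhalf : ∀ j, ρA j ≤ 1 / 2) (hρA : ∀ j, ρA j ≤ c₁ * ϑ ^ j)
    (hρBhalf : ∀ j, ρB j ≤ 1 / 2) (hρB : ∀ j, ρB j ≤ c₁ * ϑ ^ j)
    {Wsh : ℕ → ℝ} (hsum : Summable Wsh)
    (hWsh : ∀ K, ∑ s ∈ SA K, (MA (lvlA K s) * (3 * (dA (lvlA K s) + 1) / (1 - ρA (lvlA K s)))) * ρA (lvlA K s) +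
      ∑ s ∈ SB K, (MB (lvlB K s) * (3 * (dB (lvlB K s) + 1) / (1 - ρB (lvlB K s)))) * ρB (lvlB K s) ≤ Wsh K) :
    ShellWeightBound l₀ T A B shA shB Wsh :=
  shellWeightBound_mono (shellWeightBound_of_levels_dilationCoeff hA hB hwA hwB hϑ0 hϑ1 hMA0 hMA hMB0 hMB hdA0 hdA hdB0
    hdB hρAhalf hρA hρBhalf hρB) (fun K => by rw [hA.omega_eq, hB.omega_eq]; exact hWsh K) hsum

end TwoRuns

/-- **THE ∃-WEIGHT CURRENCY FROM AN ∃-PACKAGE AT A CARRIER BUNDLE.**  If a carrier bundle `S : SpineCarriers` carries the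
dilation road's package — slot types and data `(SA, pieceA, lvlA, MA, dA, ρA)`, `(SB, pieceB, lvlB, MB, dB, ρB)` with the two
`LevelLedger`s at `(S.l₀, S.T, S.A, S.shA)`, `(S.l₀, S.T, S.B, S.shB)` and constants `M_j·3(d_j+1)∕(1−ρ_j)`, two `LiveWindow`s
`(N₁, ν̄)`, a ratio `0 ≤ ϑ < 1`, polynomial bounds `M ≤ M̄(j^q+1)`, `d ≤ d₀(j^p+1)` and widths `ρ ≤ ½`, `ρ ≤ c₁ϑ^j` in both runs —
then SOME weight `Wsh` has `ShellWeightBound S.l₀ S.T S.A S.B S.shA S.shB Wsh` (the currency 21a §3 ∕ 26 §2 turn into the K5 stub).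
[folklore] -/
theorem exists_shellWeight_of_dilationLevels (S : SpineCarriers)
    (h : ∃ (σA σB : Type) (SA : ℕ → Finset σA) (SB : ℕ → Finset σB) (pieceA : ℕ → ℝ → σA → S.ι → ℝ)
      (pieceB : ℕ → ℝ → σB → S.ι → ℝ) (lvlA : ℕ → σA → ℕ) (lvlB : ℕ → σB → ℕ) (MA dA ρA MB dB ρB : ℕ → ℝ)
      (N₁ : ℕ) (νbar Mbar d₀ c₁ ϑ : ℝ) (p q : ℕ),
      LevelLedger S.l₀ S.T S.A S.shA SA pieceA lvlA (fun j => MA j * (3 * (dA j + 1) / (1 - ρA j))) ρA ∧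
      LevelLedger S.l₀ S.T S.B S.shB SB pieceB lvlB (fun j => MB j * (3 * (dB j + 1) / (1 - ρB j))) ρB ∧
      LiveWindow SA lvlA N₁ νbar ∧ LiveWindow SB lvlB N₁ νbar ∧ 0 ≤ ϑ ∧ ϑ < 1 ∧
      (∀ j, 0 ≤ MA j) ∧ (∀ j, MA j ≤ Mbar * ((j : ℝ) ^ q + 1)) ∧ (∀ j, 0 ≤ MB j) ∧ (∀ j, MB j ≤ Mbar * ((j : ℝ) ^ q + 1)) ∧
      (∀ j, 0 ≤ dA j) ∧ (∀ j, dA j ≤ d₀ * ((j : ℝ) ^ p + 1)) ∧ (∀ j, 0 ≤ dB j) ∧ (∀ j, dB j ≤ d₀ * ((j : ℝ) ^ p + 1)) ∧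
      (∀ j, ρA j ≤ 1 / 2) ∧ (∀ j, ρA j ≤ c₁ * ϑ ^ j) ∧ (∀ j, ρB j ≤ 1 / 2) ∧ (∀ j, ρB j ≤ c₁ * ϑ ^ j)) :
    ∃ Wsh : ℕ → ℝ, ShellWeightBound S.l₀ S.T S.A S.B S.shA S.shB Wsh := by
  obtain ⟨σA, σB, SA, SB, pieceA, pieceB, lvlA, lvlB, MA, dA, ρA, MB, dB, ρB, N₁, νbar, Mbar, d₀, c₁, ϑ, p, q, hA, hB, hwA, hwB,
    hϑ0, hϑ1, hMA0, hMA, hMB0, hMB, hdA0, hdA, hdB0, hdB, hρAhalf, hρA, hρBhalf, hρB⟩ := h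
  exact ⟨_, shellWeightBound_of_levels_dilationCoeff hA hB hwA hwB hϑ0 hϑ1 hMA0 hMA hMB0 hMB hdA0 hdA hdB0 hdB hρAhalf hρA
    hρBhalf hρB⟩

/-! ## §3 AT THE RECORD: the Stage-13 `CoPH` spine home `SRec₁₃CoPH cr`, its regime home `SRec₁₃CoPHOn cr Rg`, leaf D's `h21` -/

section AtRecord

variable {N : ℕ} [NeZero N] (cr : SpineReading₁₃CoPH N) (Rg : (F : T4Family) → Stage13HParams F N → Prop)

/-- ★ **THE ∃-WEIGHT FACE AT THE STAGE-13 RECORD FROM THE DILATION ROAD**: if at every admissible Stage-13 tuple with provisos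
and every `(g₀, os)` the reading's bundle `cr F θ hP g₀ os` carries the dilation road's package (§2 `exists_shellWeight_of_dilationLevels`'s
hypothesis), then at every such tuple SOME `Wsh` has `ShellWeightBound (cr …) … Wsh` — the hypothesis `hW` of 21a §3
`exists_reweight_s_N21_sRec₁₃CoPH`, 21c, 24 §4, 26 §2–§3 (`spine_rec13CCoPHOn_of_homes₁₃CoPHOn_existsShellWeight`). [bookkeeping] -/
theorem exists_shellWeight_keyed₁₃CoPH_of_dilationLevels
    (hread : ∀ (F : T4Family) (θ : Stage13HParams F N) (hP : θ.Provisos₁₃CoPH F N), θ.Admissible F N →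
      ∀ (g₀ : ℕ → ℝ) (os : List (ULoop F)), letI S := cr F θ hP g₀ os
      ∃ (σA σB : Type) (SA : ℕ → Finset σA) (SB : ℕ → Finset σB) (pieceA : ℕ → ℝ → σA → S.ι → ℝ)
        (pieceB : ℕ → ℝ → σB → S.ι → ℝ) (lvlA : ℕ → σA → ℕ) (lvlB : ℕ → σB → ℕ) (MA dA ρA MB dB ρB : ℕ → ℝ)
        (N₁ : ℕ) (νbar Mbar d₀ c₁ ϑ : ℝ) (p q : ℕ),
        LevelLedger S.l₀ S.T S.A S.shA SA pieceA lvlA (fun j => MA j * (3 * (dA j + 1) / (1 - ρA j))) ρA ∧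
        LevelLedger S.l₀ S.T S.B S.shB SB pieceB lvlB (fun j => MB j * (3 * (dB j + 1) / (1 - ρB j))) ρB ∧
        LiveWindow SA lvlA N₁ νbar ∧ LiveWindow SB lvlB N₁ νbar ∧ 0 ≤ ϑ ∧ ϑ < 1 ∧
        (∀ j, 0 ≤ MA j) ∧ (∀ j, MA j ≤ Mbar * ((j : ℝ) ^ q + 1)) ∧ (∀ j, 0 ≤ MB j) ∧ (∀ j, MB j ≤ Mbar * ((j : ℝ) ^ q + 1)) ∧
        (∀ j, 0 ≤ dA j) ∧ (∀ j, dA j ≤ d₀ * ((j : ℝ) ^ p + 1)) ∧ (∀ j, 0 ≤ dB j) ∧ (∀ j, dB j ≤ d₀ * ((j : ℝ) ^ p + 1)) ∧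
        (∀ j, ρA j ≤ 1 / 2) ∧ (∀ j, ρA j ≤ c₁ * ϑ ^ j) ∧ (∀ j, ρB j ≤ 1 / 2) ∧ (∀ j, ρB j ≤ c₁ * ϑ ^ j))
    (F : T4Family) (θ : Stage13HParams F N) (hP : θ.Provisos₁₃CoPH F N) (hθ : θ.Admissible F N) (g₀ : ℕ → ℝ)
    (os : List (ULoop F)) :
    ∃ Wsh : ℕ → ℝ, ShellWeightBound (cr F θ hP g₀ os).l₀ (cr F θ hP g₀ os).T (cr F θ hP g₀ os).A (cr F θ hP g₀ os).B
      (cr F θ hP g₀ os).shA (cr F θ hP g₀ os).shB Wsh :=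
  exists_shellWeight_of_dilationLevels (cr F θ hP g₀ os) (hread F θ hP hθ g₀ os)

/-- ★★ **THE K5 STUB `S_N21` AT THE RE-WEIGHTED STAGE-13 READING, FROM THE DILATION ROAD**: under §3's per-tuple dilation package,
SOME re-weighting `w` of the reading carries `S_N21 (SRec₁₃CoPH (fun F θ hP g₀ os ↦ { cr F θ hP g₀ os with Wsh := w F θ hP g₀ os }))`
(21a §3 `exists_reweight_s_N21_sRec₁₃CoPH` BY NAME; re-weighting is invisible to N20 ∕ N27x ∕ N19, 21a §2) — the `KeyedShellWeight`
conjunct of the K3 skeleton's `stub_expansion13` for that reading.  NOT a discharge (the ledgers are hypotheses; `cr` a parameter). [bookkeeping] -/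
theorem exists_reweight_s_N21_sRec₁₃CoPH_of_dilationLevels
    (hread : ∀ (F : T4Family) (θ : Stage13HParams F N) (hP : θ.Provisos₁₃CoPH F N), θ.Admissible F N →
      ∀ (g₀ : ℕ → ℝ) (os : List (ULoop F)), letI S := cr F θ hP g₀ os
      ∃ (σA σB : Type) (SA : ℕ → Finset σA) (SB : ℕ → Finset σB) (pieceA : ℕ → ℝ → σA → S.ι → ℝ)
        (pieceB : ℕ → ℝ → σB → S.ι → ℝ) (lvlA : ℕ → σA → ℕ) (lvlB : ℕ → σB → ℕ) (MA dA ρA MB dB ρB : ℕ → ℝ)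
        (N₁ : ℕ) (νbar Mbar d₀ c₁ ϑ : ℝ) (p q : ℕ),
        LevelLedger S.l₀ S.T S.A S.shA SA pieceA lvlA (fun j => MA j * (3 * (dA j + 1) / (1 - ρA j))) ρA ∧
        LevelLedger S.l₀ S.T S.B S.shB SB pieceB lvlB (fun j => MB j * (3 * (dB j + 1) / (1 - ρB j))) ρB ∧
        LiveWindow SA lvlA N₁ νbar ∧ LiveWindow SB lvlB N₁ νbar ∧ 0 ≤ ϑ ∧ ϑ < 1 ∧
        (∀ j, 0 ≤ MA j) ∧ (∀ j, MA j ≤ Mbar * ((j : ℝ) ^ q + 1)) ∧ (∀ j, 0 ≤ MB j) ∧ (∀ j, MB j ≤ Mbar * ((j : ℝ) ^ q + 1)) ∧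
        (∀ j, 0 ≤ dA j) ∧ (∀ j, dA j ≤ d₀ * ((j : ℝ) ^ p + 1)) ∧ (∀ j, 0 ≤ dB j) ∧ (∀ j, dB j ≤ d₀ * ((j : ℝ) ^ p + 1)) ∧
        (∀ j, ρA j ≤ 1 / 2) ∧ (∀ j, ρA j ≤ c₁ * ϑ ^ j) ∧ (∀ j, ρB j ≤ 1 / 2) ∧ (∀ j, ρB j ≤ c₁ * ϑ ^ j)) :
    ∃ w : (F : T4Family) → (θ : Stage13HParams F N) → θ.Provisos₁₃CoPH F N → (ℕ → ℝ) → List (ULoop F) → ℕ → ℝ,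
      S_N21 (SRec₁₃CoPH fun F θ hP g₀ os => { cr F θ hP g₀ os with Wsh := w F θ hP g₀ os }) :=
  exists_reweight_s_N21_sRec₁₃CoPH cr (exists_shellWeight_keyed₁₃CoPH_of_dilationLevels cr hread)

/-- **THE K5 STUB AT THE READING ITSELF**: if, in addition, the reading's own weight slot `(cr …).Wsh` is summable and dominates
the dilation road's explicit relative shell weight `ω^A K + ω^B K = Σ_{s ∈ SA K} (M·3(d+1)∕(1−ρ)·ρ)∣_{lvlA K s} + Σ_{s ∈ SB K} …`
at every admissible tuple, then `S_N21 (SRec₁₃CoPH cr)` (21a §1 `s_N21_sRec₁₃CoPH_of_le_weight` BY NAME).  NOT a discharge. [bookkeeping] -/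
theorem s_N21_sRec₁₃CoPH_of_dilationLevels
    (hread : ∀ (F : T4Family) (θ : Stage13HParams F N) (hP : θ.Provisos₁₃CoPH F N), θ.Admissible F N →
      ∀ (g₀ : ℕ → ℝ) (os : List (ULoop F)), letI S := cr F θ hP g₀ os
      Summable S.Wsh ∧
      ∃ (σA σB : Type) (SA : ℕ → Finset σA) (SB : ℕ → Finset σB) (pieceA : ℕ → ℝ → σA → S.ι → ℝ)
        (pieceB : ℕ → ℝ → σB → S.ι → ℝ) (lvlA : ℕ → σA → ℕ) (lvlB : ℕ → σB → ℕ) (MA dA ρA MB dB ρB : ℕ → ℝ)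
        (N₁ : ℕ) (νbar Mbar d₀ c₁ ϑ : ℝ) (p q : ℕ),
        LevelLedger S.l₀ S.T S.A S.shA SA pieceA lvlA (fun j => MA j * (3 * (dA j + 1) / (1 - ρA j))) ρA ∧
        LevelLedger S.l₀ S.T S.B S.shB SB pieceB lvlB (fun j => MB j * (3 * (dB j + 1) / (1 - ρB j))) ρB ∧
        LiveWindow SA lvlA N₁ νbar ∧ LiveWindow SB lvlB N₁ νbar ∧ 0 ≤ ϑ ∧ ϑ < 1 ∧
        (∀ j, 0 ≤ MA j) ∧ (∀ j, MA j ≤ Mbar * ((j : ℝ) ^ q + 1)) ∧ (∀ j, 0 ≤ MB j) ∧ (∀ j, MB j ≤ Mbar * ((j : ℝ) ^ q + 1)) ∧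
        (∀ j, 0 ≤ dA j) ∧ (∀ j, dA j ≤ d₀ * ((j : ℝ) ^ p + 1)) ∧ (∀ j, 0 ≤ dB j) ∧ (∀ j, dB j ≤ d₀ * ((j : ℝ) ^ p + 1)) ∧
        (∀ j, ρA j ≤ 1 / 2) ∧ (∀ j, ρA j ≤ c₁ * ϑ ^ j) ∧ (∀ j, ρB j ≤ 1 / 2) ∧ (∀ j, ρB j ≤ c₁ * ϑ ^ j) ∧
        (∀ K, ∑ s ∈ SA K, (MA (lvlA K s) * (3 * (dA (lvlA K s) + 1) / (1 - ρA (lvlA K s)))) * ρA (lvlA K s) +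
          ∑ s ∈ SB K, (MB (lvlB K s) * (3 * (dB (lvlB K s) + 1) / (1 - ρB (lvlB K s)))) * ρB (lvlB K s) ≤ S.Wsh K)) :
    S_N21 (SRec₁₃CoPH cr) := by
  refine s_N21_sRec₁₃CoPH_of_le_weight cr fun F θ hP hθ g₀ os => ?_
  obtain ⟨hsum, σA, σB, SA, SB, pieceA, pieceB, lvlA, lvlB, MA, dA, ρA, MB, dB, ρB, N₁, νbar, Mbar, d₀, c₁, ϑ, p, q, hA, hB, hwA,
    hwB, hϑ0, hϑ1, hMA0, hMA, hMB0, hMB, hdA0, hdA, hdB0, hdB, hρAhalf, hρA, hρBhalf, hρB, hWsh⟩ := hread F θ hP hθ g₀ os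
  exact ⟨hsum, _, shellWeightBound_of_levels_dilationCoeff hA hB hwA hwB hϑ0 hϑ1 hMA0 hMA hMB0 hMB hdA0 hdA hdB0 hdB hρAhalf
    hρA hρBhalf hρB, fun K => by rw [hA.omega_eq, hB.omega_eq]; exact hWsh K⟩

/-- **REGIME HOME, RE-WEIGHTED**: under the dilation package at every admissible Stage-13 tuple with provisos IN THE REGIME `Rg`,
SOME re-weighting carries `S_N21 (SRec₁₃CoPHOn (re-weighted cr) Rg)` (26 §2 `exists_reweight_s_N21_sRec₁₃CoPHOn` BY NAME) — the
`hW` currency of 26 §3's guarded composites.  NOT a discharge. [bookkeeping] -/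
theorem exists_reweight_s_N21_sRec₁₃CoPHOn_of_dilationLevels
    (hread : ∀ (F : T4Family) (θ : Stage13HParams F N) (hP : θ.Provisos₁₃CoPH F N), Rg F θ → θ.Admissible F N →
      ∀ (g₀ : ℕ → ℝ) (os : List (ULoop F)), letI S := cr F θ hP g₀ os
      ∃ (σA σB : Type) (SA : ℕ → Finset σA) (SB : ℕ → Finset σB) (pieceA : ℕ → ℝ → σA → S.ι → ℝ)
        (pieceB : ℕ → ℝ → σB → S.ι → ℝ) (lvlA : ℕ → σA → ℕ) (lvlB : ℕ → σB → ℕ) (MA dA ρA MB dB ρB : ℕ → ℝ)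
        (N₁ : ℕ) (νbar Mbar d₀ c₁ ϑ : ℝ) (p q : ℕ),
        LevelLedger S.l₀ S.T S.A S.shA SA pieceA lvlA (fun j => MA j * (3 * (dA j + 1) / (1 - ρA j))) ρA ∧
        LevelLedger S.l₀ S.T S.B S.shB SB pieceB lvlB (fun j => MB j * (3 * (dB j + 1) / (1 - ρB j))) ρB ∧
        LiveWindow SA lvlA N₁ νbar ∧ LiveWindow SB lvlB N₁ νbar ∧ 0 ≤ ϑ ∧ ϑ < 1 ∧
        (∀ j, 0 ≤ MA j) ∧ (∀ j, MA j ≤ Mbar * ((j : ℝ) ^ q + 1)) ∧ (∀ j, 0 ≤ MB j) ∧ (∀ j, MB j ≤ Mbar * ((j : ℝ) ^ q + 1)) ∧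
        (∀ j, 0 ≤ dA j) ∧ (∀ j, dA j ≤ d₀ * ((j : ℝ) ^ p + 1)) ∧ (∀ j, 0 ≤ dB j) ∧ (∀ j, dB j ≤ d₀ * ((j : ℝ) ^ p + 1)) ∧
        (∀ j, ρA j ≤ 1 / 2) ∧ (∀ j, ρA j ≤ c₁ * ϑ ^ j) ∧ (∀ j, ρB j ≤ 1 / 2) ∧ (∀ j, ρB j ≤ c₁ * ϑ ^ j)) :
    ∃ w : (F : T4Family) → (θ : Stage13HParams F N) → θ.Provisos₁₃CoPH F N → (ℕ → ℝ) → List (ULoop F) → ℕ → ℝ,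
      S_N21 (SRec₁₃CoPHOn (fun F θ hP g₀ os => { cr F θ hP g₀ os with Wsh := w F θ hP g₀ os }) Rg) :=
  exists_reweight_s_N21_sRec₁₃CoPHOn cr Rg fun F θ hP hRg hθ g₀ os =>
    exists_shellWeight_of_dilationLevels (cr F θ hP g₀ os) (hread F θ hP hRg hθ g₀ os)

/-- ★ **LEAF D's GUARDED `h21` BINDER SHAPE FROM THE DILATION ROAD**: under the dilation package with domination at every admissible
Stage-13 tuple with provisos IN THE REGIME `Rg`, NE7c's `ShellWeightBound` holds AT THE READING's OWN CARRIERS AND WEIGHT SLOT at every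
such tuple — at `Rg F θ := θ.ZhUnity F N ∧ θ.SlotsNondegenerate₁₃ F N`, `N = 2` this is VERBATIM the hypothesis `h21` of leaf D
`BalabanUVNodesN27SpineRecord.spineGivenEndpointR13SepCoPH_of_keyedFacesP` ∕ `_of_keyedCore` ∕ `_of_keyedFacesRatesHolder` ∕
`_of_keyedFacesHolder`, and (`Rg := ⊤`) the K3 skeleton's `KeyedShellWeight cr` up to the proviso edition.  NOT a discharge. [bookkeeping] -/
theorem shellWeightBound_guarded₁₃CoPH_of_dilationLevels
    (hread : ∀ (F : T4Family) (θ : Stage13HParams F N) (hP : θ.Provisos₁₃CoPH F N), Rg F θ → θ.Admissible F N →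
      ∀ (g₀ : ℕ → ℝ) (os : List (ULoop F)), letI S := cr F θ hP g₀ os
      Summable S.Wsh ∧
      ∃ (σA σB : Type) (SA : ℕ → Finset σA) (SB : ℕ → Finset σB) (pieceA : ℕ → ℝ → σA → S.ι → ℝ)
        (pieceB : ℕ → ℝ → σB → S.ι → ℝ) (lvlA : ℕ → σA → ℕ) (lvlB : ℕ → σB → ℕ) (MA dA ρA MB dB ρB : ℕ → ℝ)
        (N₁ : ℕ) (νbar Mbar d₀ c₁ ϑ : ℝ) (p q : ℕ),
        LevelLedger S.l₀ S.T S.A S.shA SA pieceA lvlA (fun j => MA j * (3 * (dA j + 1) / (1 - ρA j))) ρA ∧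
        LevelLedger S.l₀ S.T S.B S.shB SB pieceB lvlB (fun j => MB j * (3 * (dB j + 1) / (1 - ρB j))) ρB ∧
        LiveWindow SA lvlA N₁ νbar ∧ LiveWindow SB lvlB N₁ νbar ∧ 0 ≤ ϑ ∧ ϑ < 1 ∧
        (∀ j, 0 ≤ MA j) ∧ (∀ j, MA j ≤ Mbar * ((j : ℝ) ^ q + 1)) ∧ (∀ j, 0 ≤ MB j) ∧ (∀ j, MB j ≤ Mbar * ((j : ℝ) ^ q + 1)) ∧
        (∀ j, 0 ≤ dA j) ∧ (∀ j, dA j ≤ d₀ * ((j : ℝ) ^ p + 1)) ∧ (∀ j, 0 ≤ dB j) ∧ (∀ j, dB j ≤ d₀ * ((j : ℝ) ^ p + 1)) ∧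
        (∀ j, ρA j ≤ 1 / 2) ∧ (∀ j, ρA j ≤ c₁ * ϑ ^ j) ∧ (∀ j, ρB j ≤ 1 / 2) ∧ (∀ j, ρB j ≤ c₁ * ϑ ^ j) ∧
        (∀ K, ∑ s ∈ SA K, (MA (lvlA K s) * (3 * (dA (lvlA K s) + 1) / (1 - ρA (lvlA K s)))) * ρA (lvlA K s) +
          ∑ s ∈ SB K, (MB (lvlB K s) * (3 * (dB (lvlB K s) + 1) / (1 - ρB (lvlB K s)))) * ρB (lvlB K s) ≤ S.Wsh K))
    (F : T4Family) (θ : Stage13HParams F N) (hP : θ.Provisos₁₃CoPH F N) (hRg : Rg F θ) (hθ : θ.Admissible F N)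
    (g₀ : ℕ → ℝ) (os : List (ULoop F)) :
    ShellWeightBound (cr F θ hP g₀ os).l₀ (cr F θ hP g₀ os).T (cr F θ hP g₀ os).A (cr F θ hP g₀ os).B (cr F θ hP g₀ os).shA
      (cr F θ hP g₀ os).shB (cr F θ hP g₀ os).Wsh := by
  obtain ⟨hsum, σA, σB, SA, SB, pieceA, pieceB, lvlA, lvlB, MA, dA, ρA, MB, dB, ρB, N₁, νbar, Mbar, d₀, c₁, ϑ, p, q, hA, hB, hwA,
    hwB, hϑ0, hϑ1, hMA0, hMA, hMB0, hMB, hdA0, hdA, hdB0, hdB, hρAhalf, hρA, hρBhalf, hρB, hWsh⟩ := hread F θ hP hRg hθ g₀ os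
  exact shellWeightBound_of_levels_dilationCoeff_mono hA hB hwA hwB hϑ0 hϑ1 hMA0 hMA hMB0 hMB hdA0 hdA hdB0 hdB hρAhalf hρA
    hρBhalf hρB hsum hWsh

/-- **REGIME HOME, AT THE READING ITSELF**: the same hypotheses give `S_N21 (SRec₁₃CoPHOn cr Rg)` (dag-n19-d `s_N21_sRec₁₃CoPHOn_iff`
BY NAME) — the `h21` of dag-n27-c's guarded composites `spine_rec13CCoPHOn_of_homes₁₃CoPHOn` ∕ `…CoPHN…`.  NOT a discharge. [bookkeeping] -/
theorem s_N21_sRec₁₃CoPHOn_of_dilationLevels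
    (hread : ∀ (F : T4Family) (θ : Stage13HParams F N) (hP : θ.Provisos₁₃CoPH F N), Rg F θ → θ.Admissible F N →
      ∀ (g₀ : ℕ → ℝ) (os : List (ULoop F)), letI S := cr F θ hP g₀ os
      Summable S.Wsh ∧
      ∃ (σA σB : Type) (SA : ℕ → Finset σA) (SB : ℕ → Finset σB) (pieceA : ℕ → ℝ → σA → S.ι → ℝ)
        (pieceB : ℕ → ℝ → σB → S.ι → ℝ) (lvlA : ℕ → σA → ℕ) (lvlB : ℕ → σB → ℕ) (MA dA ρA MB dB ρB : ℕ → ℝ)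
        (N₁ : ℕ) (νbar Mbar d₀ c₁ ϑ : ℝ) (p q : ℕ),
        LevelLedger S.l₀ S.T S.A S.shA SA pieceA lvlA (fun j => MA j * (3 * (dA j + 1) / (1 - ρA j))) ρA ∧
        LevelLedger S.l₀ S.T S.B S.shB SB pieceB lvlB (fun j => MB j * (3 * (dB j + 1) / (1 - ρB j))) ρB ∧
        LiveWindow SA lvlA N₁ νbar ∧ LiveWindow SB lvlB N₁ νbar ∧ 0 ≤ ϑ ∧ ϑ < 1 ∧
        (∀ j, 0 ≤ MA j) ∧ (∀ j, MA j ≤ Mbar * ((j : ℝ) ^ q + 1)) ∧ (∀ j, 0 ≤ MB j) ∧ (∀ j, MB j ≤ Mbar * ((j : ℝ) ^ q + 1)) ∧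
        (∀ j, 0 ≤ dA j) ∧ (∀ j, dA j ≤ d₀ * ((j : ℝ) ^ p + 1)) ∧ (∀ j, 0 ≤ dB j) ∧ (∀ j, dB j ≤ d₀ * ((j : ℝ) ^ p + 1)) ∧
        (∀ j, ρA j ≤ 1 / 2) ∧ (∀ j, ρA j ≤ c₁ * ϑ ^ j) ∧ (∀ j, ρB j ≤ 1 / 2) ∧ (∀ j, ρB j ≤ c₁ * ϑ ^ j) ∧
        (∀ K, ∑ s ∈ SA K, (MA (lvlA K s) * (3 * (dA (lvlA K s) + 1) / (1 - ρA (lvlA K s)))) * ρA (lvlA K s) +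
          ∑ s ∈ SB K, (MB (lvlB K s) * (3 * (dB (lvlB K s) + 1) / (1 - ρB (lvlB K s)))) * ρB (lvlB K s) ≤ S.Wsh K)) :
    S_N21 (SRec₁₃CoPHOn cr Rg) :=
  (s_N21_sRec₁₃CoPHOn_iff cr Rg).2 (shellWeightBound_guarded₁₃CoPH_of_dilationLevels cr Rg hread)

end AtRecord

end Summit.QuantumFields.YangMills.Theorems.N21DilationRoadAtRecord13CoPH
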